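import Summits.CriticalPhenomena.PercolationContinuityZ3.Theorems.PercAnnulusCrossingIICFarSourceComparison
import Summits.CriticalPhenomena.PercolationContinuityZ3.Theorems.PercAnnulusCrossingIICSchemePositivity
import HarnessLib

/-!
# Kesten's IIC scheme with a far rider, III: TAIL DECOUPLING — `ν(E ∩ G) ≳ ϰ² ν(E) ν(G)` for an inner cylinder `E` and a far
# event `G` (lane RSW3, p1 gen 9)

builds on p205010 (kernel theorem, internal audit signed; external expert review pending)

Seat `prim-rsw3-p1` (gen 9); memo `run/shared/lean/prim/rsw3/P1-QM.md` §22.  Helper file; no definitions, no sorries; every `p`, `d`.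
Parts I–II of this gen (`…IICFarRider`, `…IICFarSourceComparison`) give, under (A2)□(ϰ) at a general aspect `σ, τ`, the SOURCE
COMPARISON `ϰ²((1−J)γ_n(C))·max 0 (P(G ∩ A_n) − Jπ(n)) ≤ P(G ∩ CONN(C;n))·π(n)` for every outward datum `C = (U,R)` and every rider `G`
living beyond `Λ(σ M₂ + 1)`.  Feeding it into the FIRST level of the scheme (annulus `(σ m₁, σ m₂)`, source `0`, inner cylinder `E`
determined by pairs of `Λ(σ m₁)`; exact summed form with rider, part I) gives:
* `level_one_of_pointwise` — finite-sum algebra of the first level;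
* **`sq_mul_max_mul_max_le_real_inter_rider_mul_oneArmProb`** — for all admissible scales
  `m₁ ≤ m₂ < σ m₂ + 1 < μ₁ < μ₂ ≤ M₁ < M₂` (`τ m₁ < σ m₂`, `τ(σ m₂ + 1) + 2 ≤ σ μ₁`, `τ μ₁ < σ μ₂`, `τ M₁ < σ M₂`, `τ M₂ < n`), with
  `J₁ = ϰ⁻² α(σ m₁, σ m₂)`, `J = ϰ⁻²(α(σ μ₁, σ μ₂) + α(σ M₁, σ M₂))`, `A_n = {0 ↔ ∂ⁱⁿΛ(n)}`:
  `ϰ²(1 − J) · max 0 (P(E ∩ A_n) − J₁ π(n)) · max 0 (P(G ∩ A_n) − J π(n)) ≤ P(E ∩ G ∩ A_n) · π(n)`;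
* **`sq_mul_max_mul_max_le_iicMeasure_real_inter`** — for every measure `ν` with Kesten's limit property at `p` (`0 < p`, `d ≥ 1`):
  `ϰ²(1 − J) · max 0 (ν(E) − J₁) · max 0 (ν(G) − J) ≤ ν(E ∩ G)`.
At `p` with `θ(p) = 0` the junk terms `J₁, J` can be made arbitrarily small by spreading the scales (part IV, `…IICZeroOneLaw`):
`ν(E ∩ G) ≥ ϰ² ν(E) ν(G)` for every tail event `G` — Kesten's IIC is trivial on the tail σ-field.
References: H. Kesten, PTRF 73 (1986) §2; D. Basu, A. Sapozhnikov, ECP 22 (2017) no. 26, §2 (2.5)–(2.8).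
-/

noncomputable section

namespace Summit.CriticalPhenomena.PercolationContinuityZ3.Theorems.Crossing

open MeasureTheory Filter Topology Literature.Probability.Percolation Literature.Probability.LatticeModels
open Literature.Probability.Percolation.DCT16
open Summit.CriticalPhenomena.PercolationContinuityZ3.Theorems.SurfaceTension
open scoped Literature.Probability.Percolation

variable {d : ℕ}

/-! ## Finite-sum algebra of the first level -/

/-- **First level, abstract**: weights `w ≥ 0` vanishing off `good`, level vectors `γ` (bare arm) and `g` (arm with rider),
the pointwise source comparison `c((1−J)γ_i)·Y ≤ g_i·π` on good data, and the two one-level inequalities `P_E − J₁π ≤ Σ w γ`,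
`Σ w g ≤ P_{E,G}` give `c(1−J)·max 0 (P_E − J₁π)·Y ≤ P_{E,G}·π`. [cite: Kesten1986, §2 eq. (22)] -/
theorem level_one_of_pointwise {ι : Type*} (s : Finset ι) (good : ι → Prop)
    {c J J₁ Y PE π PEG : ℝ} {w γ g : ι → ℝ} (hc : 0 ≤ c) (hY : 0 ≤ Y) (hπ : 0 ≤ π)
    (hw : ∀ i ∈ s, 0 ≤ w i) (hγ : ∀ i ∈ s, 0 ≤ γ i) (hg : ∀ i ∈ s, 0 ≤ g i)
    (hw0 : ∀ i ∈ s, ¬ good i → w i = 0)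
    (hpt : ∀ i ∈ s, good i → c * ((1 - J) * γ i) * Y ≤ g i * π)
    (h1 : PE - J₁ * π ≤ ∑ i ∈ s, w i * γ i) (h2 : ∑ i ∈ s, w i * g i ≤ PEG) :
    c * (1 - J) * max 0 (PE - J₁ * π) * Y ≤ PEG * π := by
  have hSwg : 0 ≤ ∑ i ∈ s, w i * g i := Finset.sum_nonneg fun i hi => mul_nonneg (hw i hi) (hg i hi)
  have hSwγ : 0 ≤ ∑ i ∈ s, w i * γ i := Finset.sum_nonneg fun i hi => mul_nonneg (hw i hi) (hγ i hi)
  have hPEG : 0 ≤ PEG := hSwg.trans h2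
  rcases lt_or_ge (1 - J) 0 with hJ | hJ
  · have h0 : c * (1 - J) ≤ 0 := mul_nonpos_of_nonneg_of_nonpos hc hJ.le
    exact (mul_nonpos_of_nonpos_of_nonneg (mul_nonpos_of_nonpos_of_nonneg h0 (le_max_left _ _)) hY).trans
      (mul_nonneg hPEG hπ)
  have hsum : ∑ i ∈ s, w i * (c * ((1 - J) * γ i) * Y) ≤ ∑ i ∈ s, w i * (g i * π) := by
    refine Finset.sum_le_sum fun i hi => ?_
    by_cases hgi : good i
    · exact mul_le_mul_of_nonneg_left (hpt i hi hgi) (hw i hi)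
    · rw [hw0 i hi hgi]; simp
  have hL : ∑ i ∈ s, w i * (c * ((1 - J) * γ i) * Y) = c * (1 - J) * Y * ∑ i ∈ s, w i * γ i := by
    rw [Finset.mul_sum]
    exact Finset.sum_congr rfl fun i _ => by ring
  have hR : ∑ i ∈ s, w i * (g i * π) = (∑ i ∈ s, w i * g i) * π := by
    rw [Finset.sum_mul]
    exact Finset.sum_congr rfl fun i _ => by ring
  have hmax : max 0 (PE - J₁ * π) ≤ ∑ i ∈ s, w i * γ i := max_le hSwγ h1
  calc c * (1 - J) * max 0 (PE - J₁ * π) * Y = c * (1 - J) * Y * max 0 (PE - J₁ * π) := by ring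
    _ ≤ c * (1 - J) * Y * ∑ i ∈ s, w i * γ i :=
        mul_le_mul_of_nonneg_left hmax (mul_nonneg (mul_nonneg hc hJ) hY)
    _ = ∑ i ∈ s, w i * (c * ((1 - J) * γ i) * Y) := hL.symm
    _ ≤ ∑ i ∈ s, w i * (g i * π) := hsum
    _ = (∑ i ∈ s, w i * g i) * π := hR
    _ ≤ PEG * π := mul_le_mul_of_nonneg_right h2 hπ

/-! ## The finite-volume decoupling inequality -/

/-- **TAIL DECOUPLING AT FINITE VOLUME**: under (A2)□(ϰ) at a general aspect (`σ, τ` monotone, `m < σ m < τ m`), for scales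
`1 ≤ m₁ ≤ m₂`, `τ m₁ < σ m₂`, `τ(σ m₂ + 1) + 2 ≤ σ μ₁`, `τ μ₁ < σ μ₂`, `μ₂ ≤ M₁`, `τ M₁ < σ M₂`, `τ M₂ < n`, an inner cylinder `E`
determined by pairs of `Λ(σ m₁)` and a rider `G` determined by finitely many pairs disjoint from the pairs of `Λ(σ M₂ + 1)`:
`ϰ²(1 − J)·max 0 (P(E ∩ A_n) − J₁π_p(n))·max 0 (P(G ∩ A_n) − Jπ_p(n)) ≤ P(E ∩ G ∩ A_n)·π_p(n)`,
`J₁ = ϰ⁻²α(σ m₁,σ m₂)`, `J = ϰ⁻²(α(σ μ₁,σ μ₂) + α(σ M₁,σ M₂))`, `A_n = {0 ↔ ∂ⁱⁿΛ(n)}`.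
[cite: Kesten1986, §2 eq. (22), Lemma (23)] [cite: BasuSapozhnikov2017ECP, §2 (2.5)–(2.8)] -/
theorem sq_mul_max_mul_max_le_real_inter_rider_mul_oneArmProb (p : unitInterval) {ϰ : ℝ} (hϰ : 0 < ϰ)
    {σ τ : ℕ → ℕ} (hσ : ∀ m : ℕ, 1 ≤ m → m < σ m) (hστ : ∀ m : ℕ, 1 ≤ m → σ m < τ m)
    (hσm : Monotone σ) (hτm : Monotone τ)
    (hA2 : ∀ m : ℕ, 1 ≤ m → ∀ Z : Finset (Site d), box d (τ m) \ box d (m - 1) ⊆ Z →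
      ∀ X : Finset (Site d), X ⊆ Z ∩ box d m → ∀ Y : Finset (Site d), Y ⊆ Z \ box d (τ m) →
        ϰ * (bondPercolation (zdGraph d) p).real {ω | ∃ x ∈ X, ∃ s ∈ innerBoundary (zdGraph d) (box d (σ m)),
              ω ∈ openConnIn (↑Z : Set (Site d)) x s} *
          (bondPercolation (zdGraph d) p).real {ω | ∃ y ∈ Y, ∃ s ∈ innerBoundary (zdGraph d) (box d (σ m)),
              ω ∈ openConnIn (↑Z : Set (Site d)) y s} ≤
        (bondPercolation (zdGraph d) p).real {ω | ∃ x ∈ X, ∃ y ∈ Y, ω ∈ openConnIn (↑Z : Set (Site d)) x y})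
    {m₁ m₂ μ₁ μ₂ M₁ M₂ n : ℕ} (hm₁ : 1 ≤ m₁) (hm₁₂ : m₁ ≤ m₂) (h12 : τ m₁ < σ m₂)
    (hmμ : τ (σ m₂ + 1) + 2 ≤ σ μ₁) (hμ12 : τ μ₁ < σ μ₂) (hμM : μ₂ ≤ M₁) (hM12 : τ M₁ < σ M₂) (hn : τ M₂ < n)
    {E : Set (BondConfig (Site d))} {F : Finset (Sym2 (Site d))} (hE : DeterminedBy E ↑F) (hF : F ⊆ (box d (σ m₁)).sym2)
    {G : Set (BondConfig (Site d))} {S : Finset (Sym2 (Site d))} (hG : DeterminedBy G ↑S)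
    (hS : Disjoint S (box d (σ M₂ + 1)).sym2) :
    ϰ ^ 2 * (1 - ϰ⁻¹ ^ 2 * ((bondPercolation (zdGraph d) p).real (boxCrossing d (σ μ₁) (σ μ₂)) +
        (bondPercolation (zdGraph d) p).real (boxCrossing d (σ M₁) (σ M₂)))) *
      max 0 ((bondPercolation (zdGraph d) p).real (E ∩ siteToBoundary d n) -
        ϰ⁻¹ ^ 2 * (bondPercolation (zdGraph d) p).real (boxCrossing d (σ m₁) (σ m₂)) * oneArmProb d p n) *
      max 0 ((bondPercolation (zdGraph d) p).real (G ∩ siteToBoundary d n) -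
        ϰ⁻¹ ^ 2 * ((bondPercolation (zdGraph d) p).real (boxCrossing d (σ μ₁) (σ μ₂)) +
          (bondPercolation (zdGraph d) p).real (boxCrossing d (σ M₁) (σ M₂))) * oneArmProb d p n) ≤
      (bondPercolation (zdGraph d) p).real (E ∩ G ∩ siteToBoundary d n) * oneArmProb d p n := by
  classical
  have hσ1 := hσ m₁ hm₁
  have hστ1 := hστ m₁ hm₁
  have hσ2 := hσ m₂ (by omega)
  have hστ2 := hστ m₂ (by omega)
  have hm : 1 ≤ σ m₂ + 1 := by omega
  have hσ0 := hσ (σ m₂ + 1) hm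
  have hστ0 := hστ (σ m₂ + 1) hm
  have hmμ' : σ m₂ + 1 < μ₁ := hσm.reflect_lt (by omega)
  have hσμ1 := hσ μ₁ (by omega)
  have hστμ1 := hστ μ₁ (by omega)
  have hμ12' : μ₁ < μ₂ := hσm.reflect_lt (by omega)
  have hσμM : σ μ₂ ≤ σ M₁ := hσm hμM
  have hσM1 := hσ M₁ (by omega)
  have hστM1 := hστ M₁ (by omega)
  have hM12' : M₁ < M₂ := hσm.reflect_lt (by omega)
  have hστM2 := hστ M₂ (by omega)
  have hτm2 : τ m₂ ≤ τ (σ m₂ + 1) := hτm (by omega)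
  have hn₁ : τ m₂ < n := by omega
  set P := bondPercolation (zdGraph d) p with hP
  have h0H : (∅ : Finset (Site d)) ⊆ box d (m₁ - 1) := Finset.empty_subset _
  have h0X : ({0} : Finset (Site d)) ⊆ box d m₁ := Finset.singleton_subset_iff.2 (zero_mem_box d m₁)
  have h0XH : ∀ x ∈ ({0} : Finset (Site d)), x ∉ (∅ : Finset (Site d)) := fun x _ => Finset.notMem_empty x
  have hS₁ : Disjoint S (box d (σ m₂ + 1)).sym2 :=
    hS.mono_right (Finset.sym2_mono (box_mono d (by omega)))
  have hlev := sum_real_level_two_sided_aspect p hϰ hσ hστ hA2 hm₁ hm₁₂ h12 hn₁ h0H h0X h0XH hE hF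
  have hlevr := sum_real_level_two_sided_aspect_rider p hϰ hσ hστ hA2 hm₁ hm₁₂ h12 hn₁ h0H h0X h0XH hE hF hG hS₁
  have hπ : P.real (siteToBoundary d n) = oneArmProb d p n := rfl
  rw [conn_empty_zero_eq, hπ] at hlev hlevr
  refine level_one_of_pointwise
    (((box d (σ m₂)).powerset.filter (fun U => box d (σ m₁) ⊆ U)) ×ˢ (box d (σ m₂ + 1)).powerset)
    (fun C => ∀ r ∈ C.2, r ∉ box d (σ m₂)) (pow_pos hϰ 2).le (le_max_left _ _) measureReal_nonneg
    ?_ ?_ ?_ ?_ ?_ hlev.1 hlevr.2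
  · exact fun _ _ => measureReal_nonneg
  · exact fun _ _ => measureReal_nonneg
  · exact fun _ _ => measureReal_nonneg
  · -- a datum whose rim meets the box has probability zero
    intro C hC hbad
    push Not at hbad
    obtain ⟨r, hr, hrb⟩ := hbad
    rw [Finset.mem_product, Finset.mem_filter, Finset.mem_powerset, Finset.mem_powerset] at hC
    exact le_antisymm ((measureReal_mono (fun ω hω => hω.1.1.2) (measure_ne_top _ _)).trans
      (real_dat_eq_zero_of_mem_box p (by omega : σ m₁ ≤ σ m₂) hC.1.1 hr hrb).le) measureReal_nonneg
  · -- the source comparison of part II, for the datum `C = (U,R)` read as inner data at scale `σ m₂ + 1`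
    intro C hC hgood
    rw [Finset.mem_product, Finset.mem_filter, Finset.mem_powerset, Finset.mem_powerset] at hC
    have hH' : C.1 ⊆ box d (σ m₂ + 1 - 1) := by rw [Nat.add_sub_cancel]; exact hC.1.1
    exact sq_mul_le_real_rider_conn_mul_oneArmProb p hϰ hσ hστ hσm hτm hA2 hm hmμ hμ12 hμM hM12 hn hH' hC.2
      (fun x hx hxU => hgood x hx (hC.1.1 hxU)) hG hS

/-! ## The decoupling inequality for Kesten's IIC -/

/-- **TAIL DECOUPLING FOR KESTEN'S IIC**: for every measure `ν` with Kesten's limit property at `p` (`0 < p`, `d ≥ 1`;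
`P_p(· ∩ A_n)/π_p(n) → ν(·)` on cylinder events), under (A2)□(ϰ) at a general aspect and with the scales and events of
`sq_mul_max_mul_max_le_real_inter_rider_mul_oneArmProb`:
`ϰ²(1 − J)·max 0 (ν(E) − J₁)·max 0 (ν(G) − J) ≤ ν(E ∩ G)`.
[cite: Kesten1986, Thm. (3) and §2] [cite: BasuSapozhnikov2017ECP, Thm. 1.1, §2] -/
theorem sq_mul_max_mul_max_le_iicMeasure_real_inter (hd : 1 ≤ d) (p : unitInterval) (hp : 0 < (p : ℝ))
    {ϰ : ℝ} (hϰ : 0 < ϰ)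
    {σ τ : ℕ → ℕ} (hσ : ∀ m : ℕ, 1 ≤ m → m < σ m) (hστ : ∀ m : ℕ, 1 ≤ m → σ m < τ m)
    (hσm : Monotone σ) (hτm : Monotone τ)
    (hA2 : ∀ m : ℕ, 1 ≤ m → ∀ Z : Finset (Site d), box d (τ m) \ box d (m - 1) ⊆ Z →
      ∀ X : Finset (Site d), X ⊆ Z ∩ box d m → ∀ Y : Finset (Site d), Y ⊆ Z \ box d (τ m) →
        ϰ * (bondPercolation (zdGraph d) p).real {ω | ∃ x ∈ X, ∃ s ∈ innerBoundary (zdGraph d) (box d (σ m)),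
              ω ∈ openConnIn (↑Z : Set (Site d)) x s} *
          (bondPercolation (zdGraph d) p).real {ω | ∃ y ∈ Y, ∃ s ∈ innerBoundary (zdGraph d) (box d (σ m)),
              ω ∈ openConnIn (↑Z : Set (Site d)) y s} ≤
        (bondPercolation (zdGraph d) p).real {ω | ∃ x ∈ X, ∃ y ∈ Y, ω ∈ openConnIn (↑Z : Set (Site d)) x y})
    {m₁ m₂ μ₁ μ₂ M₁ M₂ : ℕ} (hm₁ : 1 ≤ m₁) (hm₁₂ : m₁ ≤ m₂) (h12 : τ m₁ < σ m₂)
    (hmμ : τ (σ m₂ + 1) + 2 ≤ σ μ₁) (hμ12 : τ μ₁ < σ μ₂) (hμM : μ₂ ≤ M₁) (hM12 : τ M₁ < σ M₂)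
    {E : Set (BondConfig (Site d))} {F : Finset (Sym2 (Site d))} (hE : DeterminedBy E ↑F) (hF : F ⊆ (box d (σ m₁)).sym2)
    {G : Set (BondConfig (Site d))} {S : Finset (Sym2 (Site d))} (hG : DeterminedBy G ↑S)
    (hS : Disjoint S (box d (σ M₂ + 1)).sym2)
    {ν : Measure (BondConfig (Site d))}
    (hν : ∀ (F : Finset (Sym2 (Site d))) (E : Set (BondConfig (Site d))), MeasurableSet E → DeterminedBy E ↑F →
      Tendsto (fun n : ℕ => (bondPercolation (zdGraph d) p).real (E ∩ siteToBoundary d n) / oneArmProb d p n)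
        atTop (𝓝 (ν.real E))) :
    ϰ ^ 2 * (1 - ϰ⁻¹ ^ 2 * ((bondPercolation (zdGraph d) p).real (boxCrossing d (σ μ₁) (σ μ₂)) +
        (bondPercolation (zdGraph d) p).real (boxCrossing d (σ M₁) (σ M₂)))) *
      max 0 (ν.real E - ϰ⁻¹ ^ 2 * (bondPercolation (zdGraph d) p).real (boxCrossing d (σ m₁) (σ m₂))) *
      max 0 (ν.real G - ϰ⁻¹ ^ 2 * ((bondPercolation (zdGraph d) p).real (boxCrossing d (σ μ₁) (σ μ₂)) +
          (bondPercolation (zdGraph d) p).real (boxCrossing d (σ M₁) (σ M₂)))) ≤ ν.real (E ∩ G) := by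
  classical
  set P := bondPercolation (zdGraph d) p with hP
  set J₁ := ϰ⁻¹ ^ 2 * P.real (boxCrossing d (σ m₁) (σ m₂)) with hJ₁
  set J := ϰ⁻¹ ^ 2 * (P.real (boxCrossing d (σ μ₁) (σ μ₂)) + P.real (boxCrossing d (σ M₁) (σ M₂))) with hJ
  have hπpos : ∀ n, 0 < oneArmProb d p n := oneArmProb_pos hd p hp
  have hEt := hν F E hE.measurableSet_of_finset hE
  have hGt := hν S G hG.measurableSet_of_finset hG
  have hEG : DeterminedBy (E ∩ G) ↑(F ∪ S) := by
    rw [Finset.coe_union]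
    exact (hE.mono Set.subset_union_left).inter (hG.mono Set.subset_union_right)
  have hEGt := hν (F ∪ S) (E ∩ G) hEG.measurableSet_of_finset hEG
  -- the finite-volume inequality, divided by `π_p(n)²`
  have hkey : ∀ n : ℕ, τ M₂ < n →
      ϰ ^ 2 * (1 - J) * max 0 (P.real (E ∩ siteToBoundary d n) / oneArmProb d p n - J₁) *
          max 0 (P.real (G ∩ siteToBoundary d n) / oneArmProb d p n - J) ≤
        P.real (E ∩ G ∩ siteToBoundary d n) / oneArmProb d p n := by
    intro n hn
    have hπ := hπpos n
    have hfin := sq_mul_max_mul_max_le_real_inter_rider_mul_oneArmProb p hϰ hσ hστ hσm hτm hA2 hm₁ hm₁₂ h12 hmμ hμ12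
      hμM hM12 hn hE hF hG hS
    have e1 : max 0 (P.real (E ∩ siteToBoundary d n) / oneArmProb d p n - J₁) * oneArmProb d p n =
        max 0 (P.real (E ∩ siteToBoundary d n) - J₁ * oneArmProb d p n) := by
      rw [max_mul_of_nonneg _ _ hπ.le, zero_mul, sub_mul, div_mul_cancel₀ _ hπ.ne']
    have e2 : max 0 (P.real (G ∩ siteToBoundary d n) / oneArmProb d p n - J) * oneArmProb d p n =
        max 0 (P.real (G ∩ siteToBoundary d n) - J * oneArmProb d p n) := by
      rw [max_mul_of_nonneg _ _ hπ.le, zero_mul, sub_mul, div_mul_cancel₀ _ hπ.ne']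
    have e3 : P.real (E ∩ G ∩ siteToBoundary d n) / oneArmProb d p n * oneArmProb d p n =
        P.real (E ∩ G ∩ siteToBoundary d n) := div_mul_cancel₀ _ hπ.ne'
    refine le_of_mul_le_mul_right ?_ (mul_pos hπ hπ)
    calc ϰ ^ 2 * (1 - J) * max 0 (P.real (E ∩ siteToBoundary d n) / oneArmProb d p n - J₁) *
            max 0 (P.real (G ∩ siteToBoundary d n) / oneArmProb d p n - J) * (oneArmProb d p n * oneArmProb d p n)
        = ϰ ^ 2 * (1 - J) * (max 0 (P.real (E ∩ siteToBoundary d n) / oneArmProb d p n - J₁) * oneArmProb d p n) *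
            (max 0 (P.real (G ∩ siteToBoundary d n) / oneArmProb d p n - J) * oneArmProb d p n) := by ring
      _ = ϰ ^ 2 * (1 - J) * max 0 (P.real (E ∩ siteToBoundary d n) - J₁ * oneArmProb d p n) *
            max 0 (P.real (G ∩ siteToBoundary d n) - J * oneArmProb d p n) := by rw [e1, e2]
      _ ≤ P.real (E ∩ G ∩ siteToBoundary d n) * oneArmProb d p n := by
          rw [hJ₁, hJ]; exact hfin
      _ = P.real (E ∩ G ∩ siteToBoundary d n) / oneArmProb d p n * (oneArmProb d p n * oneArmProb d p n) := by
          rw [← mul_assoc, e3]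
  -- pass to the limit
  have hL : Tendsto (fun n : ℕ => ϰ ^ 2 * (1 - J) * max 0 (P.real (E ∩ siteToBoundary d n) / oneArmProb d p n - J₁) *
      max 0 (P.real (G ∩ siteToBoundary d n) / oneArmProb d p n - J)) atTop
      (𝓝 (ϰ ^ 2 * (1 - J) * max 0 (ν.real E - J₁) * max 0 (ν.real G - J))) :=
    ((tendsto_const_nhds.mul (tendsto_const_nhds.max (hEt.sub tendsto_const_nhds))).mul
      (tendsto_const_nhds.max (hGt.sub tendsto_const_nhds)))
  exact le_of_tendsto_of_tendsto hL hEGt (eventually_atTop.2 ⟨τ M₂ + 1, fun n hn => hkey n (by omega)⟩)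

end Summit.CriticalPhenomena.PercolationContinuityZ3.Theorems.Crossing

end
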